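import Summits.Ventures.PercRepro.S4MidKeyTenFortyfiveC1
import Summits.Ventures.PercRepro.S4MidKeyTenFortyfiveC2
import Summits.Ventures.PercRepro.S4MidKeyTenFortyfiveD1

/-!
# PercRepro — THE MIDDLE KEY AT LEVEL `10`, RANK `45` (p1 g47, S4 feeder — p9 owns SUBCLAIM-S4; no window claim here)

Part of the middle key at rank `45`, level `10` (n₀ = 733, 7 layers; p1 g47): the certificate of proofs/P1-HYPKEY.md §16 split into a chain of
explicit linear forms by layers and by size so that every `linear_combination` stays under the gate's 600-second verification limit (§16 (e)).
Nothing is claimed below `n₀`. Axioms: standard.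
-/

open scoped Matroid

namespace PercRepro

namespace S4Mid

open Set Finset S2LP S3Mid

variable {α : Type}

set_option maxHeartbeats 64000000 in
set_option maxRecDepth 20000 in
set_option linter.unusedSimpArgs false in
/-- **THE MIDDLE KEY AT RANK `45`, LEVEL `10`** (7 layers = ranks `10 … 17`): `RLS M 45 10` for every `e`-free `M` on `n ≥ 733` points (`d ≥ 688`). -/
theorem c025_core_ten_midkey_fortyfive (M : Matroid α) [M.Finite] (hn : 733 ≤ M.E.ncard)
    (hfree : ∀ e ∈ M.E, ∃ A ⊆ M.E \ {e}, e ∉ M.closure A ∧ e ∉ M.closure ((M.E \ {e}) \ A)) :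
    ThmN.RLS M 45 10 := by
  classical
  have hphi : phiK 45 10 = 1033111283426 / 838695 := by
    rw [HypKey.phiK_eq_two_pow_sub 45 10 (by norm_num), Nat.choose_symm_add]
    simp only [Finset.sum_range_succ, Finset.sum_range_zero]
    norm_num [Nat.choose_eq_descFactorial_div_factorial, Nat.descFactorial_succ, Nat.descFactorial_zero, Nat.factorial]
  have hY := S3LP.yRow (M := M) 10 45
  have hPrev1 := c025_core_ten_midkey_fortyfive_c1 M hn hfree
  have hPrev2 := c025_core_ten_midkey_fortyfive_c2 M hn hfree
  have hPrev3 := c025_core_ten_midkey_fortyfive_d1 M hn hfree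
  simp only [rminL, Finset.sum_range_succ, Finset.sum_range_zero, Nat.reduceAdd, Nat.reduceSub, Nat.reduceMul, Nat.reduceEqDiff, Nat.reduceLeDiff, ↓reduceIte, zero_add, add_zero, zero_mul, mul_zero, one_mul, mul_one, Nat.add_sub_cancel] at hY
  rw [ThmN.RLS_iff, hphi]
  qify at hY
  have hn0 : ∀ s : Set (Set α), (0 : ℚ) ≤ (s.ncard : ℚ) := fun s => Nat.cast_nonneg _
  have N : ∀ k r : ℕ, (0 : ℚ) ≤ ((S1.rkSets M k r).ncard : ℚ) := fun k r => hn0 _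
  linear_combination (((((-1) * hY + (1 * hPrev1 + 1 * hPrev2)) + ((1 * hPrev3 + 1 * hn0 (S1.rankSet M 18)) + (1 * hn0 (S1.rankSet M 19) + 1 * hn0 (S1.rankSet M 20)))) + (((1 * hn0 (S1.rankSet M 21) + 1 * hn0 (S1.rankSet M 22)) + (1 * hn0 (S1.rankSet M 23) + 1 * hn0 (S1.rankSet M 24))) + ((1 * hn0 (S1.rankSet M 25) + 1 * hn0 (S1.rankSet M 26)) + (1 * hn0 (S1.rankSet M 27) + 1 * hn0 (S1.rankSet M 28))))) + ((((1 * hn0 (S1.rankSet M 29) + 1 * hn0 (S1.rankSet M 30)) + (1 * hn0 (S1.rankSet M 31) + 1 * hn0 (S1.rankSet M 32))) + ((1 * hn0 (S1.rankSet M 33) + 1 * hn0 (S1.rankSet M 34)) + (1 * hn0 (S1.rankSet M 35) + 1 * hn0 (S1.rankSet M 36)))) + (((1 * hn0 (S1.rankSet M 37) + 1 * hn0 (S1.rankSet M 38)) + (1 * hn0 (S1.rankSet M 39) + 1 * hn0 (S1.rankSet M 40))) + ((1 * hn0 (S1.rankSet M 41) + 1 * hn0 (S1.rankSet M 42)) +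 (1 * hn0 (S1.rankSet M 43) + 1 * hn0 (S1.rankSet M 44))))))

end S4Mid

end PercRepro
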